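import Summits.AnomalousDissipation.AnomalousDissipation.Theses.DecimationAxis
import Literature.Analysis.FluidPDE.GalerkinFlow

/-!
# Stub-ideation k2 (RESHAPE family) — `stub_uniformGalerkinAnomaly` of `Cruxes/GalerkinFloor/Lines/birth.lean`

Typed helper lemmas and the two reshaped cores (segment currency, cone currency) for
`STUB-IDEAS-stub_uniformGalerkinAnomaly-2.md`.  §0 is the skeleton's vocabulary VERBATIM; `Heart` is the stub's
statement VERBATIM.  Everything below `Heart` is sorried ON PURPOSE: these are the proposed one-cycle helper targets
(H0–H6) and the two assembly statements; nothing here is claimed proved.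
-/

noncomputable section

set_option linter.dupNamespace false

open Filter Set
open Literature.Analysis.FunctionSpaces.Torus Literature.Analysis.FluidPDE

namespace Summit.AnomalousDissipation.AnomalousDissipation.Cruxes.GalerkinFloor.StubIdeas2

open Summit.AnomalousDissipation.AnomalousDissipation.Theses.DecimationAxis

local notation "ℤ³" => Fin 3 → ℤ
local notation "ℂ³" => EuclideanSpace ℂ (Fin 3)

/-! ## §0 Vocabulary — verbatim from `Lines/birth.lean` -/

def IsDesignerForce (N : ℕ) (g : ℤ³ → ℂ³) : Prop :=
  IsConjSymm g ∧ (∀ k, k ∉ freqBall N → g k = 0) ∧ g 0 = 0 ∧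
    (∀ k : ℤ³, ∑ i, ((k i : ℤ) : ℂ) * g k i = 0)

def IsCoeffTrajectory (S : Finset ℤ³) (ν : ℝ) (g : ℤ³ → ℂ³) (c : ℝ → ↥S → ℂ³) : Prop :=
  (∀ t, c t ∈ galerkinSubspace S) ∧ ContinuousOn c (Set.Ici 0) ∧
    (∀ T : ℝ, ∀ t ∈ Set.Icc (0 : ℝ) T,
      HasDerivWithinAt c (galerkinRHS S ν (fun k => g k) (c t)) (Set.Icc 0 T) t)

def coeffEnergy {S : Finset ℤ³} (c : ℝ → ↥S → ℂ³) : ℝ → ℝ :=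
  fun t => ∑ k : ↥S, ‖c t k‖ ^ 2

def coeffDissipation {S : Finset ℤ³} (ν : ℝ) (c : ℝ → ↥S → ℂ³) : ℝ → ℝ :=
  fun t => ν * (4 * Real.pi ^ 2 * ∑ k : ↥S, freqNormSq (k : ℤ³) * ‖c t k‖ ^ 2)

/-- The stub's statement, VERBATIM (`Lines/birth.lean: stub_uniformGalerkinAnomaly`). -/
def Heart : Prop :=
    ∃ (N : ℕ) (g : ℤ³ → ℂ³), IsDesignerForce N g ∧ ∃ (E ε : ℝ), 0 < ε ∧ ∃ ν : ℕ → ℝ,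
      (∀ j, 0 < ν j) ∧ Tendsto ν atTop (nhds 0) ∧
      ∀ j, ∃ K₀ : ℕ, ∀ K, K₀ ≤ K → ∀ S : Finset ℤ³, S = (freqBall K).erase 0 →
        ∃ c : ℝ → ↥S → ℂ³, IsCoeffTrajectory S (ν j) g c ∧
          longTimeAvgSup (coeffEnergy c) ≤ E ∧ ε ≤ longTimeAvgInf (coeffDissipation (ν j) c)

/-! ## §1 New vocabulary of the reshaping: injected power ("work") and the force size -/

/-- Injected power `W(t) = Σ_{k∈S} Re⟪g_k, c_k(t)⟫ = ∫⟪G, u(t)⟫` along a coefficient trajectory. -/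
def coeffWork {S : Finset ℤ³} (g : ℤ³ → ℂ³) (c : ℝ → ↥S → ℂ³) : ℝ → ℝ :=
  fun t => ∑ k : ↥S, (inner ℂ (g k) (c t k)).re

/-- `ℓ²` size of the force on `S`: `G_S = √(Σ_{k∈S} ‖g_k‖²)` (≤ the same sum over `freqBall N`). -/
def forceSize (S : Finset ℤ³) (g : ℤ³ → ℂ³) : ℝ :=
  Real.sqrt (∑ k ∈ S, ‖g k‖ ^ 2)

/-! ## §2 PLAN 1 — penalised-work segments + window selection (segment currency) -/

/-- **Core C1 (open; the reshaped heart in SEGMENT CURRENCY).**  Some designer force, a penalty `lam > 0`, a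
margin `m > 0`, a deficit `C₀` and `ν_j → 0⁺` such that for every `j`, eventually in `K`, inside ONE absorbing
energy ball of radius `ρ ≥ G_S/(4π²ν_j)`, for EVERY horizon `T` SOME Galerkin trajectory started in the ball has
penalised work `∫₀ᵀ (W − lam·En − m) ≥ −C₀`.  Each instance `(j, K, T)` is a FINITE-HORIZON property of one
polynomial ODE. -/
def LoudSegments : Prop :=
  ∃ (N : ℕ) (g : ℤ³ → ℂ³), IsDesignerForce N g ∧ ∃ (lam m C₀ : ℝ), 0 < lam ∧ 0 < m ∧ ∃ ν : ℕ → ℝ,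
    (∀ j, 0 < ν j) ∧ Tendsto ν atTop (nhds 0) ∧
    ∀ j, ∃ K₀ : ℕ, ∀ K, K₀ ≤ K → ∀ S : Finset ℤ³, S = (freqBall K).erase 0 →
      ∃ ρ : ℝ, forceSize S g / (4 * Real.pi ^ 2 * ν j) ≤ ρ ∧
        ∀ T : ℝ, 0 ≤ T → ∃ c : ℝ → ↥S → ℂ³, IsCoeffTrajectory S (ν j) g c ∧ coeffEnergy c 0 ≤ ρ ^ 2 ∧
          -C₀ ≤ ∫ t in (0 : ℝ)..T, (coeffWork g c t - lam * coeffEnergy c t - m)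

/-- **H0 (S–M) — absorbing energy balls.**  Along a Galerkin trajectory on `S ∌ 0` the ball `En ≤ ρ²` is forward
invariant once `ρ ≥ G_S/(4π²ν)`: `d/dt En = 2(W − D) ≤ 2(G_S √En − 4π²ν En)` (`hasDerivWithinAt_energy`,
`toReal_eGradNormSq_coeffExt`, `freqNormSq k ≥ 1` on `S`). -/
theorem coeffEnergy_le_of_initial_le {S : Finset ℤ³} (hS : ∀ k ∈ S, -k ∈ S) (h0 : (0 : ℤ³) ∉ S)
    {ν : ℝ} (hν : 0 < ν) {g : ℤ³ → ℂ³} (hg : IsConjSymm g) {c : ℝ → ↥S → ℂ³}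
    (hc : IsCoeffTrajectory S ν g c) {ρ : ℝ} (hρ : forceSize S g / (4 * Real.pi ^ 2 * ν) ≤ ρ)
    (h0c : coeffEnergy c 0 ≤ ρ ^ 2) : ∀ t, 0 ≤ t → coeffEnergy c t ≤ ρ ^ 2 := by
  sorry

/-- **H1 (M–L) — WINDOW SELECTION for the Galerkin coefficient semiflow** (port of the tree's
`Literature.Dynamics.Ergodic.exists_orbit_integral_bounded_below`, stated there for Lipschitz fields on
`EuclideanSpace ℝ (Fin d)`, to `galerkinCoeffFlow` on a compact forward-invariant set; robust form with a deficit
`C₀`).  If for every horizon some orbit segment in `B` has `∫₀ᵀ f ≥ −C₀`, then ONE orbit in `B` has ALL its running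
integrals bounded below.  Ingredients: `continuousOn_galerkinCoeffFlow`, `galerkinCoeffFlow_add`, compactness of `B`
(uniform "drop time", then iterate: the contradiction `sup_b ∫₀ᵀ f ≤ −T/T* + const`). -/
theorem exists_orbit_runningIntegral_bounded_below {S : Finset ℤ³} (hS : ∀ k ∈ S, -k ∈ S) {ν : ℝ}
    (hν : 0 ≤ ν) {g : ↥S → ℂ³} (hg : IsRealCoeff g) {B : Set (↥S → ℂ³)} (hB : IsCompact B)
    (hne : B.Nonempty) (hBV : B ⊆ (galerkinSubspace S : Set (↥S → ℂ³)))
    (hinv : ∀ t, 0 ≤ t → Set.MapsTo (galerkinCoeffFlow ν g t) B B)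
    {f : (↥S → ℂ³) → ℝ} (hf : ContinuousOn f B) {C₀ : ℝ}
    (hseg : ∀ T, 0 ≤ T → ∃ b ∈ B, -C₀ ≤ ∫ t in (0 : ℝ)..T, f (galerkinCoeffFlow ν g t b)) :
    ∃ b ∈ B, ∃ C : ℝ, ∀ T, 0 ≤ T → -C ≤ ∫ t in (0 : ℝ)..T, f (galerkinCoeffFlow ν g t b) := by
  sorry

/-- **H1′ (M) — the same lemma for an abstract semiflow on a compact metric space** (the natural generality; the
hypotheses are those of `Literature.Dynamics.Ergodic.exists_invariantMeasure_tendsto_timeAverage_semiflow`). -/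
theorem exists_point_runningIntegral_bounded_below {X : Type*} [MetricSpace X] [CompactSpace X]
    [Nonempty X] {φ : ℝ → X → X} (hcont : ContinuousOn (fun q : ℝ × X => φ q.1 q.2) (Ici 0 ×ˢ univ))
    (h0 : ∀ x, φ 0 x = x) (hadd : ∀ s t, 0 ≤ s → 0 ≤ t → ∀ x, φ (s + t) x = φ s (φ t x))
    {f : X → ℝ} (hf : Continuous f) {C₀ : ℝ}
    (hseg : ∀ T, 0 ≤ T → ∃ x, -C₀ ≤ ∫ t in (0 : ℝ)..T, f (φ t x)) :
    ∃ x, ∃ C : ℝ, ∀ T, 0 ≤ T → -C ≤ ∫ t in (0 : ℝ)..T, f (φ t x) := by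
  sorry

/-- **H2 (M) — the time-integrated Galerkin energy identity on `IsCoeffTrajectory`**:
`En(T) − En(0) = 2∫₀ᵀ (W − D)` (`hasDerivWithinAt_energy` / `galerkin_energy_identity` rewritten through
`toReal_eGradNormSq_coeffExt`, `integral_inner_realTrigPoly_realTrigPoly`, `isRealCoeff_restrict`). -/
theorem coeffEnergy_sub_eq_integral {S : Finset ℤ³} (hS : ∀ k ∈ S, -k ∈ S) {ν : ℝ} {g : ℤ³ → ℂ³}
    (hg : IsConjSymm g) {c : ℝ → ↥S → ℂ³} (hc : IsCoeffTrajectory S ν g c) {T : ℝ} (hT : 0 ≤ T) :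
    coeffEnergy c T - coeffEnergy c 0 =
      2 * ∫ t in (0 : ℝ)..T, (coeffWork g c t - coeffDissipation ν c t) := by
  sorry

/-- **H3 (M) — conversion: bounded orbit + running penalised work bounded below ⇒ the stub's two clauses with
EXPLICIT budgets** `E = (G/lam)²`, `ε = m` (H2 + Cauchy–Schwarz `W ≤ G_S √En`, `∫₀ᵀ √En ≤ √T √(∫₀ᵀ En)`;
tree: `timeMean_sqrt_le_sqrt_timeMean`, `timeMean_add`, `longTimeAvgSup_le_of_eventually_le`). -/
theorem heartClauses_of_runningIntegral {S : Finset ℤ³} (hS : ∀ k ∈ S, -k ∈ S) {ν : ℝ} (hν : 0 < ν)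
    {g : ℤ³ → ℂ³} (hg : IsConjSymm g) {c : ℝ → ↥S → ℂ³} (hc : IsCoeffTrajectory S ν g c)
    {ρ : ℝ} (hbd : ∀ t, 0 ≤ t → coeffEnergy c t ≤ ρ ^ 2) {G lam m C : ℝ} (hG : forceSize S g ≤ G)
    (hlam : 0 < lam) (hm : 0 < m)
    (hrun : ∀ T, 0 ≤ T → -C ≤ ∫ t in (0 : ℝ)..T, (coeffWork g c t - lam * coeffEnergy c t - m)) :
    longTimeAvgSup (coeffEnergy c) ≤ (G / lam) ^ 2 ∧ m ≤ longTimeAvgInf (coeffDissipation ν c) := by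
  sorry

/-- **Assembly of Plan 1** (bookkeeping once H0–H3 are in): `LoudSegments → Heart` with `E := (G/lam)²`,
`G := forceSize (freqBall N) g`, `ε := m`; `B := {b ∈ galerkinSubspace S | Σ‖b_k‖² ≤ ρ²}`,
`f := W − lam·En − m`; the selected orbit `t ↦ galerkinCoeffFlow (ν j) (g↾S) t b` is an `IsCoeffTrajectory`
(`isGalerkinODESolution_galerkinCoeffFlow`; segments are identified with flow orbits by
`IsGalerkinODESolution.galerkinCoeffFlow_eq`). -/
theorem heart_of_loudSegments : LoudSegments → Heart := by
  sorry

/-- **Converse (S–M; certifies that C1 is a currency change, not a strengthening)**: a heart witness has, for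
`lam := ε/(4(E+1))`, `m := ε/4`, `C₀ := 0`, good windows of every length among `[iT, (i+1)T]` (pigeonhole on
`Σ_{i<n} ∫_{iT}^{(i+1)T} f ≥ 0` for `n` large). -/
theorem loudSegments_of_heart : Heart → LoudSegments := by
  sorry

/-! ## §3 PLAN 2 — Taylor cone + energy floor (cone currency, amplitude-free) -/

/-- **Core C2 (open; the heart in CONE CURRENCY)**: one projective inequality `κ ∫₀ᵀ En ≤ ∫₀ᵀ D` eventually in
`T`, on some bounded trajectory, eventually in `K`, along `ν_j → 0⁺`. -/
def TaylorCone : Prop :=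
  ∃ (N : ℕ) (g : ℤ³ → ℂ³), IsDesignerForce N g ∧ g ≠ 0 ∧ ∃ κ : ℝ, 0 < κ ∧ ∃ ν : ℕ → ℝ,
    (∀ j, 0 < ν j) ∧ Tendsto ν atTop (nhds 0) ∧
    ∀ j, ∃ K₀ : ℕ, ∀ K, K₀ ≤ K → ∀ S : Finset ℤ³, S = (freqBall K).erase 0 →
      ∃ c : ℝ → ↥S → ℂ³, IsCoeffTrajectory S (ν j) g c ∧ (∃ ρ : ℝ, ∀ t, 0 ≤ t → coeffEnergy c t ≤ ρ ^ 2) ∧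
        ∃ T₀ : ℝ, ∀ T, T₀ ≤ T →
          κ * ∫ t in (0 : ℝ)..T, coeffEnergy c t ≤ ∫ t in (0 : ℝ)..T, coeffDissipation (ν j) c t

/-- **H4 (M–L) — ENERGY FLOOR along bounded Galerkin trajectories, uniform in `K ≥ N` and `ν ≤ ν₀`** (trajectory
transcription of the landed law-side `stub_energyFloor`, MomentParity…StubEnergyFloor.lean): test the Galerkin
equation against `a := realTrigPoly (freqBall N) g` (`sum_re_inner_galerkinField_test`), integrate
`d/dt Re Σ⟪ĝ_k, c_k⟫ = ‖G‖² + ν∫⟪u, ΔG⟫ + ∫⟪u, (u·∇)G⟫` over `[0, T]`, bound `|∫⟪u,(u·∇)G⟫| ≤ ‖∇G‖_∞ En`. -/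
theorem energyFloor_trajectory {N : ℕ} {g : ℤ³ → ℂ³} (hg : IsDesignerForce N g) (hg0 : g ≠ 0) :
    ∃ e₀ ν₀ : ℝ, 0 < e₀ ∧ 0 < ν₀ ∧ ∀ ν : ℝ, 0 < ν → ν ≤ ν₀ → ∀ K : ℕ, N ≤ K → ∀ S : Finset ℤ³,
      S = (freqBall K).erase 0 → ∀ c : ℝ → ↥S → ℂ³, IsCoeffTrajectory S ν g c →
        (∃ ρ : ℝ, ∀ t, 0 ≤ t → coeffEnergy c t ≤ ρ ^ 2) → e₀ ≤ longTimeAvgInf (coeffEnergy c) := by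
  sorry

/-- **H5 (M) — cone conversion**: cone + energy floor + H2 ⇒ the stub's clauses with `E := (G/κ)²`, `ε := κ e₀`. -/
theorem heartClauses_of_cone {S : Finset ℤ³} (hS : ∀ k ∈ S, -k ∈ S) {ν : ℝ} (hν : 0 < ν)
    {g : ℤ³ → ℂ³} (hg : IsConjSymm g) {c : ℝ → ↥S → ℂ³} (hc : IsCoeffTrajectory S ν g c)
    {ρ : ℝ} (hbd : ∀ t, 0 ≤ t → coeffEnergy c t ≤ ρ ^ 2) {G κ e₀ : ℝ} (hG : forceSize S g ≤ G)
    (hκ : 0 < κ) (he : e₀ ≤ longTimeAvgInf (coeffEnergy c))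
    (hcone : ∃ T₀ : ℝ, ∀ T, T₀ ≤ T →
      κ * ∫ t in (0 : ℝ)..T, coeffEnergy c t ≤ ∫ t in (0 : ℝ)..T, coeffDissipation ν c t) :
    longTimeAvgSup (coeffEnergy c) ≤ (G / κ) ^ 2 ∧ κ * e₀ ≤ longTimeAvgInf (coeffDissipation ν c) := by
  sorry

/-- **Assembly of Plan 2**: `TaylorCone → Heart` (re-index `j ↦ j + J` so that `ν_j ≤ ν₀`, take `K₀ ≥ N`;
cf. the law-side `stub_taylorReduction` on stmt-14283). -/
theorem heart_of_taylorCone : TaylorCone → Heart := by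
  sorry

/-! ## §4 PLAN 3 — import edges (RECOGNISE & IMPORT, zero-risk wiring) -/

/-- **H6 (S) — loud bounded STEADY Galerkin states at all large levels give the heart** (constant trajectories:
`hasDerivWithinAt_const`, `timeMean` of a constant).  Antecedent = the eventually-in-`K` steady Galerkin zeroth
law (MirrorVariety / Windy territory). -/
theorem heart_of_steadyLoudAllLevels
    (h : ∃ (N : ℕ) (g : ℤ³ → ℂ³), IsDesignerForce N g ∧ ∃ (E ε : ℝ), 0 < ε ∧ ∃ ν : ℕ → ℝ,
      (∀ j, 0 < ν j) ∧ Tendsto ν atTop (nhds 0) ∧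
      ∀ j, ∃ K₀ : ℕ, ∀ K, K₀ ≤ K → ∀ S : Finset ℤ³, S = (freqBall K).erase 0 →
        ∃ c₀ : ↥S → ℂ³, c₀ ∈ galerkinSubspace S ∧ galerkinRHS S (ν j) (fun k => g k) c₀ = 0 ∧
          ∑ k : ↥S, ‖c₀ k‖ ^ 2 ≤ E ∧
          ε ≤ ν j * (4 * Real.pi ^ 2 * ∑ k : ↥S, freqNormSq (k : ℤ³) * ‖c₀ k‖ ^ 2)) :
    Heart := by
  sorry

end Summit.AnomalousDissipation.AnomalousDissipation.Cruxes.GalerkinFloor.StubIdeas2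

end
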